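import Literature.Probability.Process.KolmogorovChentsovHolder
import Mathlib.Analysis.SpecificLimits.Normed
import Mathlib.Analysis.SpecialFunctions.Pow.Real
import Mathlib.Analysis.SpecialFunctions.Sqrt
import HarnessLib

/-!
# Tightness of Hölder norms from increment bounds (quantitative Kolmogorov–Chentsov; Kemppainen–Smirnov Prop. 3.8 / Thm. 3.9)

Topic `Literature/Probability/Process`; theorems only (no named fact). The dyadic chaining of
`KolmogorovChentsov.lean` / `KolmogorovChentsovHolder.lean` (Le Gall (2016), Lemma 2.10) is there
used qualitatively (almost surely, eventually in the level, there is SOME Hölder constant). This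
file extracts the QUANTITATIVE statement that the same argument proves and that tightness
arguments consume: an explicit Hölder constant `C(γ, n₀, N) = 2 (1 - 2^{-γ})⁻¹ (N 2^{n₀+1} + 1)`
for paths whose increments over consecutive level-`m` dyadics of `[0, N]` are `≤ 2^{-γ m}` for
all `m > n₀`, and a bound on the probability that a random continuous path fails to be Hölder
with that constant, by the union bound over the dyadic increments. Three instances:

* `holderOnWith_of_increments_le` — **deterministic**: small consecutive dyadic increments beyond
  level `n₀` ⟹ `HolderOnWith C(γ, n₀, N) γ f [0, N]` for a continuous path `f` (near-diagonal
  pairs by chaining, distant pairs by finitely many short steps);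
* `measure_not_holderOnWith_le_tsum` — **union bound**: for a process with a.s. continuous paths,
  `P{¬ Hölder with C(γ, n₀, N)} ≤ ∑_{m > n₀} N 2^m · p_m` whenever `p_m` bounds the
  probability of a single level-`m` increment exceeding `2^{-γ m}` (no measurability needed:
  outer measure);
* `measure_not_holderOnWith_le_of_isKolmogorovProcess`, `exists_holderConst_of_isKolmogorovProcess`
  — **Kolmogorov's moment condition** `E[d(X_s, X_t)^p] ≤ M |s - t|^q`, `γ p < q - 1`:
  `P{¬ Hölder} ≤ N M ρ^{n₀+1} (1 - ρ)⁻¹`, `ρ = 2^{-(q-1-γp)}`, hence for every `ε > 0` ONE constant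
  `C` with `P{¬ HolderOnWith C γ X [0, N]} ≤ ε` for EVERY process satisfying the condition with
  the same `(p, q, M)` — the tightness form of the Kolmogorov–Chentsov criterion (the moment
  criterion for tightness in `C[0, N]`);
* `measure_not_holderOnWith_le_of_subexp_tails`, `exists_holderConst_of_subexp_tails` —
  **Kemppainen–Smirnov's sub-exponential increment tails** (Ann. Probab. 45 (2017), Prop. 3.8 (2)
  and Thm. 3.9, "see Lemma 7.1.6 and the proof of Theorem 7.1.5 in [Durrett]"): if
  `P{λ ≤ d(X_s, X_t)} ≤ K exp(-c λ / √(t - s))` for `s < t ≤ N`, `t - s ≤ 1`, `λ > 0` (KS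
  Prop. 3.7 with eq. (10) give this for the Loewner driving process of a random curve under
  Condition G2, `√(t-s)` being the diffusive scaling of capacity time), then for `0 < α < 1/2` and
  `ε > 0` there is ONE constant `C = C(α, K, c, N, ε)` with `P{¬ HolderOnWith C α X [0, N]} ≤ ε`
  for every such process: the `α`-Hölder norm of `X|[0, N]` is stochastically bounded in the
  family (KS Thm. 3.9: "the `α`-Hölder norm of the driving process restricted to `[0, T]` … is
  stochastically bounded"), which is the driving-modulus input `drvMod` of
  `RandomPlanarGeometry/LoewnerRegularCurves.lean`;
* `exists_modulus_of_subexp_tails`, `exists_scales_of_subexp_tails` — the same for all horizons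
  at once (union bound over `T` at levels `ε 2^{-(T+1)}`): ONE family of moduli `μ T → 0` at
  `0⁺`, resp. ONE family of box scales `δW k > 0` ("`s, t ≤ k+1`, `|s - t| ≤ δW k` ⟹
  `d(X_s, X_t) ≤ 1/(k+1)`", the clauses of `Process.modulusSet`), violated with probability
  `≤ ε` — KS's event `E₃` of §3.5 in the two shapes consumed by `LoewnerRegularCurves.lean`
  (`IsRegularCurve.driving_modulus`) and `LoewnerRegularBoxes.lean` (`Process.modulusSet`).

Only consecutive-dyadic two-time bounds are used, so the hypotheses are weaker than the
running-supremum events `G_n` of KS Prop. 3.8 (2). Deliberately NOT here: the model-specific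
derivation of the tail bound (KS Prop. 3.7, eq. (10): `RandomPlanarGeometry/KSRectangleExit.lean`,
`RandomPlanarGeometry/LoewnerDrivingBound.lean`) and the running-maximum bound KS Prop. 3.8 (1).

## References

* A. Kemppainen, S. Smirnov, *Random curves, scaling limits and Loewner evolutions*, Ann. Probab.
  45 (2017) 698–779, §3.3: Prop. 3.8 (2), Thm. 3.9 (arXiv:1212.6215 pp. 16–17).
  [KemppainenSmirnov2017]
* J.-F. Le Gall, *Brownian Motion, Martingales, and Stochastic Calculus* (2016), Thm. 2.9,
  Lemma 2.10. [Legall2016]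
* R. Durrett, *Probability: Theory and Examples* (5th ed., 2019), Thm. 8.1.3 (= Thm. 7.1.5 with
  Lemma 7.1.6 of the 1996 edition cited by Kemppainen–Smirnov). [Durrett2019]
-/

noncomputable section

open MeasureTheory ProbabilityTheory Filter Set
open scoped ENNReal NNReal Topology

namespace Literature.Probability.Process

open KolmogorovChentsov

universe u

variable {E : Type*}

namespace KolmogorovChentsov

/-! ### The explicit Hölder constant

The constant is `C(γ, n₀, N) = 2 (1 - 2^{-γ})⁻¹ · (N 2^{n₀+1} + 1)` — Le Gall's chaining constant
`2 (1 - 2^{-γ})⁻¹` (Lemma 2.10) times the number of steps of length `2^{-(n₀+1)}` needed to cross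
`[0, N]`, plus one — written out in the statements (as an element of `ℝ≥0` through
`ENNReal.toNNReal`; no definition is introduced). -/

/-- `2^{-γ} < 1` in `ℝ≥0∞` for `γ > 0`. [folklore] -/
theorem two_rpow_neg_lt_one' {γ : ℝ} (hγ : 0 < γ) : (2 : ℝ≥0∞) ^ (-γ) < 1 :=
  ENNReal.rpow_lt_one_of_one_lt_of_neg ENNReal.one_lt_two (neg_neg_of_pos hγ)

/-- Le Gall's chaining constant `2 (1 - 2^{-γ})⁻¹` is finite for `γ > 0`.
[cite: Legall2016, Lemma 2.10] -/
theorem chainingConst_ne_top {γ : ℝ} (hγ : 0 < γ) : 2 * (1 - (2 : ℝ≥0∞) ^ (-γ))⁻¹ ≠ ∞ :=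
  ENNReal.mul_ne_top (by simp)
    (ENNReal.inv_ne_top.2 (tsub_pos_of_lt (two_rpow_neg_lt_one' hγ)).ne')

/-- The explicit Hölder constant, read back in `ℝ≥0∞`. [folklore] -/
theorem coe_toNNReal_holderBound {γ : ℝ} (hγ : 0 < γ) (n₀ N : ℕ) :
    (((2 * (1 - (2 : ℝ≥0∞) ^ (-γ))⁻¹ * ((N : ℝ≥0∞) * 2 ^ (n₀ + 1) + 1)).toNNReal : ℝ≥0) : ℝ≥0∞) =
      2 * (1 - (2 : ℝ≥0∞) ^ (-γ))⁻¹ * ((N : ℝ≥0∞) * 2 ^ (n₀ + 1) + 1) := by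
  rw [ENNReal.coe_toNNReal]
  exact ENNReal.mul_ne_top (chainingConst_ne_top hγ) (ENNReal.add_ne_top.2
    ⟨ENNReal.mul_ne_top (ENNReal.natCast_ne_top N) (ENNReal.pow_ne_top ENNReal.ofNat_ne_top),
      ENNReal.one_ne_top⟩)

/-! ### Deterministic: small dyadic increments give the explicit Hölder bound -/

section Deterministic

variable [PseudoEMetricSpace E]

/-- **Small consecutive dyadic increments beyond level `n₀` force an explicit Hölder bound.** If
`f : ℝ≥0 → E` is continuous and `edist (f (k/2^m)) (f ((k+1)/2^m)) ≤ 2^{-γ m}` for all `m > n₀`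
and `(k+1)/2^m ≤ N`, then `f` is `γ`-Hölder on `[0, N]` with the explicit constant `C(γ, n₀, N)`:
pairs at distance `< 2^{-n₀}` by dyadic chaining (`edist_le_mul_rpow_of_increments_le`, passed
to all points by continuity), distant pairs by at most `N 2^{n₀+1}` steps of length
`2^{-(n₀+1)}`. The constant depends on `(γ, n₀, N)` only, which is what tightness arguments use.
[cite: Legall2016, Lemma 2.10 and proof of Thm 2.9] -/
theorem holderOnWith_of_increments_le {f : ℝ≥0 → E} (hf : Continuous f) {γ : ℝ≥0}
    (hγ : 0 < γ) {N n₀ : ℕ}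
    (h : ∀ m, n₀ < m → ∀ k, k + 1 ≤ N * 2 ^ m →
      edist (f (dyad m k)) (f (dyad m (k + 1))) ≤ ((2 : ℝ≥0∞) ^ (-(γ : ℝ))) ^ m) :
    HolderOnWith
      ((2 * (1 - (2 : ℝ≥0∞) ^ (-(γ : ℝ)))⁻¹ * ((N : ℝ≥0∞) * 2 ^ (n₀ + 1) + 1)).toNNReal)
      γ f (Icc 0 N) := by
  have hγ' : 0 < (γ : ℝ) := NNReal.coe_pos.2 hγ
  -- the near-diagonal bound, for all points of `[0, N]`
  have hloc : ∀ s t : ℝ≥0, s ≤ N → t ≤ N → dist s t < ((2 : ℝ) ^ n₀)⁻¹ →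
      edist (f s) (f t) ≤ 2 * (1 - (2 : ℝ≥0∞) ^ (-(γ : ℝ)))⁻¹ * edist s t ^ (γ : ℝ) := by
    intro s t hs ht hd
    refine edist_le_mul_rpow_of_dyadics hf (chainingConst_ne_top hγ') (N := N)
      (ρ := ((2 : ℝ) ^ n₀)⁻¹) ?_ hs ht hd
    intro s' hs' t' ht' hs'N ht'N hd'
    exact edist_le_mul_rpow_of_increments_le hγ' h hs' ht' hs'N ht'N hd'
  -- short steps of length `ρ' = 2^{-(n₀+1)}`
  set ρ' : ℝ≥0 := ((2 : ℝ≥0) ^ (n₀ + 1))⁻¹ with hρ'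
  have hρ'real : (ρ' : ℝ) = ((2 : ℝ) ^ (n₀ + 1))⁻¹ := by simp [hρ']
  have hρ'lt : (ρ' : ℝ) < ((2 : ℝ) ^ n₀)⁻¹ := by
    rw [hρ'real, inv_lt_inv₀ (by positivity) (by positivity)]
    exact pow_lt_pow_right₀ one_lt_two (Nat.lt_succ_self n₀)
  set B : ℝ≥0∞ := 2 * (1 - (2 : ℝ≥0∞) ^ (-(γ : ℝ)))⁻¹ * (ρ' : ℝ≥0∞) ^ (γ : ℝ) with hB
  have hstep : ∀ s t : ℝ≥0, s ≤ t → t ≤ N → t - s ≤ ρ' → edist (f s) (f t) ≤ B := by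
    intro s t hst htN hts
    have hdist : dist s t ≤ ρ' := by
      rw [dist_comm, NNReal.dist_eq, abs_of_nonneg (by simpa using hst)]
      have := NNReal.coe_le_coe.2 hts
      rwa [NNReal.coe_sub hst] at this
    calc edist (f s) (f t) ≤ 2 * (1 - (2 : ℝ≥0∞) ^ (-(γ : ℝ)))⁻¹ * edist s t ^ (γ : ℝ) :=
          hloc s t (hst.trans htN) htN (hdist.trans_lt hρ'lt)
      _ ≤ 2 * (1 - (2 : ℝ≥0∞) ^ (-(γ : ℝ)))⁻¹ * (ρ' : ℝ≥0∞) ^ (γ : ℝ) := by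
          gcongr
          rw [edist_dist, ← ENNReal.ofReal_coe_nnreal]
          exact ENNReal.ofReal_le_ofReal hdist
  -- `[0, N]` is crossed in `N 2^{n₀+1}` short steps
  have hfar : ∀ s t : ℝ≥0, s ≤ t → t ≤ N →
      edist (f s) (f t) ≤ ((N * 2 ^ (n₀ + 1) : ℕ) : ℝ≥0∞) * B := by
    intro s t hst htN
    refine edist_le_mul_of_steps hstep (N * 2 ^ (n₀ + 1)) s t hst htN ?_
    have hN : ((N * 2 ^ (n₀ + 1) : ℕ) : ℝ≥0) * ρ' = N := by
      rw [hρ']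
      push_cast
      rw [mul_assoc, mul_inv_cancel₀ (by positivity), mul_one]
    rw [hN]
    exact tsub_le_self.trans htN
  -- conclusion
  intro x hx y hy
  rw [coe_toNNReal_holderBound hγ']
  by_cases hxy : dist x y < ((2 : ℝ) ^ n₀)⁻¹
  · calc edist (f x) (f y) ≤ 2 * (1 - (2 : ℝ≥0∞) ^ (-(γ : ℝ)))⁻¹ * edist x y ^ (γ : ℝ) := hloc x y hx.2 hy.2 hxy
      _ = 2 * (1 - (2 : ℝ≥0∞) ^ (-(γ : ℝ)))⁻¹ * 1 * edist x y ^ (γ : ℝ) := by rw [mul_one]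
      _ ≤ 2 * (1 - (2 : ℝ≥0∞) ^ (-(γ : ℝ)))⁻¹ * ((N : ℝ≥0∞) * 2 ^ (n₀ + 1) + 1) * edist x y ^ (γ : ℝ) := by
          gcongr
          exact le_add_self
  · rw [not_lt] at hxy
    -- `ρ' ≤ dist x y`, so `ρ' ^ γ ≤ edist x y ^ γ`
    have hρxy : (ρ' : ℝ≥0∞) ^ (γ : ℝ) ≤ edist x y ^ (γ : ℝ) := by
      gcongr
      rw [edist_dist, ← ENNReal.ofReal_coe_nnreal]
      exact ENNReal.ofReal_le_ofReal (hρ'lt.le.trans hxy)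
    have key : edist (f x) (f y) ≤ ((N * 2 ^ (n₀ + 1) : ℕ) : ℝ≥0∞) * B := by
      rcases le_total x y with hle | hle
      · exact hfar x y hle hy.2
      · rw [edist_comm]; exact hfar y x hle hx.2
    calc edist (f x) (f y) ≤ ((N * 2 ^ (n₀ + 1) : ℕ) : ℝ≥0∞) * B := key
      _ = 2 * (1 - (2 : ℝ≥0∞) ^ (-(γ : ℝ)))⁻¹ * ((N : ℝ≥0∞) * 2 ^ (n₀ + 1)) * (ρ' : ℝ≥0∞) ^ (γ : ℝ) := by
          rw [hB]; push_cast; ring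
      _ ≤ 2 * (1 - (2 : ℝ≥0∞) ^ (-(γ : ℝ)))⁻¹ * ((N : ℝ≥0∞) * 2 ^ (n₀ + 1)) * edist x y ^ (γ : ℝ) := by gcongr
      _ ≤ 2 * (1 - (2 : ℝ≥0∞) ^ (-(γ : ℝ)))⁻¹ * ((N : ℝ≥0∞) * 2 ^ (n₀ + 1) + 1) * edist x y ^ (γ : ℝ) := by
          gcongr
          exact le_self_add

end Deterministic

/-! ### The union bound over dyadic increments -/

section UnionBound

variable [PseudoEMetricSpace E] {Ω : Type*} [MeasurableSpace Ω]

/-- **Union bound**: for a process `X` with almost surely continuous paths, the probability that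
a path fails to be `γ`-Hölder on `[0, N]` with the explicit constant `C(γ, n₀, N)` is at most
`∑_{m > n₀} N 2^m · bnd_m`, where `bnd_m` bounds the probability that a single consecutive
level-`m` dyadic increment on `[0, N]` exceeds `2^{-γ m}` (contrapositive of
`holderOnWith_of_increments_le`; outer measure, no measurability assumption).
[cite: Legall2016, proof of Thm 2.9] -/
theorem measure_not_holderOnWith_le_tsum (P : Measure Ω) {X : ℝ≥0 → Ω → E}
    (hX : ∀ᵐ ω ∂P, Continuous (X · ω)) {γ : ℝ≥0} (hγ : 0 < γ) (N n₀ : ℕ) {bnd : ℕ → ℝ≥0∞}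
    (hbnd : ∀ m, n₀ < m → ∀ k, k + 1 ≤ N * 2 ^ m →
      P {ω | ((2 : ℝ≥0∞) ^ (-(γ : ℝ))) ^ m < edist (X (dyad m k) ω) (X (dyad m (k + 1)) ω)} ≤
        bnd m) :
    P {ω | ¬ HolderOnWith
      ((2 * (1 - (2 : ℝ≥0∞) ^ (-(γ : ℝ)))⁻¹ * ((N : ℝ≥0∞) * 2 ^ (n₀ + 1) + 1)).toNNReal)
      γ (X · ω) (Icc 0 N)} ≤
      ∑' i, ((N * 2 ^ (n₀ + 1 + i) : ℕ) : ℝ≥0∞) * bnd (n₀ + 1 + i) := by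
  set r : ℝ≥0∞ := (2 : ℝ≥0∞) ^ (-(γ : ℝ)) with hr
  -- the bad events, level by level beyond `n₀`
  set A : ℕ → Set Ω := fun i ↦ ⋃ k ∈ Finset.range (N * 2 ^ (n₀ + 1 + i)),
    {ω | r ^ (n₀ + 1 + i) < edist (X (dyad (n₀ + 1 + i) k) ω) (X (dyad (n₀ + 1 + i) (k + 1)) ω)}
    with hA
  -- off the bad events, a continuous path is Hölder with the explicit constant
  have hsub : {ω | ¬ HolderOnWith
      ((2 * (1 - (2 : ℝ≥0∞) ^ (-(γ : ℝ)))⁻¹ * ((N : ℝ≥0∞) * 2 ^ (n₀ + 1) + 1)).toNNReal)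
      γ (X · ω) (Icc 0 N)} ⊆
      (⋃ i, A i) ∪ {ω | ¬ Continuous (X · ω)} := by
    intro ω hω
    by_contra hω'
    simp only [Set.mem_union, Set.mem_iUnion, Set.mem_setOf_eq, not_or, not_exists,
      not_not] at hω'
    obtain ⟨hgood, hcont⟩ := hω'
    refine hω (holderOnWith_of_increments_le hcont hγ fun m hm k hk ↦ ?_)
    rw [← not_lt]
    intro hlt
    obtain ⟨i, rfl⟩ : ∃ i, m = n₀ + 1 + i := ⟨m - (n₀ + 1), by omega⟩
    refine hgood i ?_
    simp only [hA, Set.mem_iUnion, Finset.mem_range, Set.mem_setOf_eq, exists_prop]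
    exact ⟨k, by omega, hlt⟩
  have hcont0 : P {ω | ¬ Continuous (X · ω)} = 0 := by
    rw [ae_iff] at hX
    exact hX
  have hAi : ∀ i, P (A i) ≤ ((N * 2 ^ (n₀ + 1 + i) : ℕ) : ℝ≥0∞) * bnd (n₀ + 1 + i) := by
    intro i
    calc P (A i) ≤ ∑ k ∈ Finset.range (N * 2 ^ (n₀ + 1 + i)),
          P {ω | r ^ (n₀ + 1 + i) <
            edist (X (dyad (n₀ + 1 + i) k) ω) (X (dyad (n₀ + 1 + i) (k + 1)) ω)} :=
          measure_biUnion_finset_le _ _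
      _ ≤ ∑ _k ∈ Finset.range (N * 2 ^ (n₀ + 1 + i)), bnd (n₀ + 1 + i) :=
          Finset.sum_le_sum fun k hk ↦ hbnd _ (by omega) k
            (by have := Finset.mem_range.1 hk; omega)
      _ = ((N * 2 ^ (n₀ + 1 + i) : ℕ) : ℝ≥0∞) * bnd (n₀ + 1 + i) := by
          rw [Finset.sum_const, Finset.card_range, nsmul_eq_mul]
  calc P {ω | ¬ HolderOnWith
            ((2 * (1 - (2 : ℝ≥0∞) ^ (-(γ : ℝ)))⁻¹ * ((N : ℝ≥0∞) * 2 ^ (n₀ + 1) + 1)).toNNReal)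
            γ (X · ω) (Icc 0 N)}
      ≤ P ((⋃ i, A i) ∪ {ω | ¬ Continuous (X · ω)}) := measure_mono hsub
    _ ≤ P (⋃ i, A i) + P {ω | ¬ Continuous (X · ω)} := measure_union_le _ _
    _ = P (⋃ i, A i) := by rw [hcont0, add_zero]
    _ ≤ ∑' i, P (A i) := measure_iUnion_le _
    _ ≤ ∑' i, ((N * 2 ^ (n₀ + 1 + i) : ℕ) : ℝ≥0∞) * bnd (n₀ + 1 + i) := ENNReal.tsum_le_tsum hAi

end UnionBound

/-! ### Kolmogorov's moment condition: the tightness form of the Kolmogorov–Chentsov criterion -/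

section Kolmogorov

variable [PseudoEMetricSpace E] {Ω : Type*} {mΩ : MeasurableSpace Ω} {P : Measure Ω} {p q : ℝ}
  {M : ℝ≥0} {X : ℝ≥0 → Ω → E}

/-- Under the Kolmogorov condition, a single consecutive level-`m` dyadic increment exceeds
`2^{-γ m}` with probability at most `M (2⁻ᵐ)^q / ((2^{-γ})^m)^p` (Markov's inequality).
[cite: Legall2016, proof of Thm 2.9] -/
theorem measure_increment_gt_le (hX : IsKolmogorovProcess X P p q M) (γ : ℝ) (m k : ℕ) :
    P {ω | ((2 : ℝ≥0∞) ^ (-γ)) ^ m < edist (X (dyad m k) ω) (X (dyad m (k + 1)) ω)} ≤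
      (M : ℝ≥0∞) * ((2 : ℝ≥0∞)⁻¹ ^ m) ^ q / (((2 : ℝ≥0∞) ^ (-γ)) ^ m) ^ p := by
  set r : ℝ≥0∞ := (2 : ℝ≥0∞) ^ (-γ) with hr
  have hr0 : r ≠ 0 := by simp [hr, ENNReal.rpow_eq_zero_iff]
  have hrtop : r ≠ ∞ := by simp [hr, ENNReal.rpow_eq_top_iff]
  have hsub : {ω | r ^ m < edist (X (dyad m k) ω) (X (dyad m (k + 1)) ω)}
      ⊆ {ω | r ^ m ≤ edist (X (dyad m k) ω) (X (dyad m (k + 1)) ω)} :=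
    fun ω hω ↦ Set.mem_setOf.2 (le_of_lt (Set.mem_setOf.1 hω))
  rw [ENNReal.le_div_iff_mul_le (Or.inl _) (Or.inl _), mul_comm]
  · calc (r ^ m) ^ p * P {ω | r ^ m < edist (X (dyad m k) ω) (X (dyad m (k + 1)) ω)}
        ≤ (r ^ m) ^ p * P {ω | r ^ m ≤ edist (X (dyad m k) ω) (X (dyad m (k + 1)) ω)} :=
          mul_le_mul_right (measure_mono hsub) _
      _ ≤ M * edist (dyad m k) (dyad m (k + 1)) ^ q := rpow_mul_measure_le hX _ _ _
      _ = M * ((2 : ℝ≥0∞)⁻¹ ^ m) ^ q := by rw [edist_dyad_succ]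
  · exact (ENNReal.rpow_pos (ENNReal.pow_pos (pos_iff_ne_zero.2 hr0) _)
      (ENNReal.pow_ne_top hrtop)).ne'
  · exact ENNReal.rpow_ne_top_of_nonneg hX.p_pos.le (ENNReal.pow_ne_top hrtop)

/-- **Quantitative Kolmogorov–Chentsov.** Under the Kolmogorov condition
`E[d(X_s, X_t)^p] ≤ M |s-t|^q` with almost surely continuous paths, for `0 < γ` and every level
`n₀`, the probability that a path fails to be `γ`-Hölder on `[0, N]` with the explicit
constant `C(γ, n₀, N)` is at most `N M ρ^{n₀+1} (1 - ρ)⁻¹`, `ρ = 2^{-(q-1-γp)}` (finite and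
geometrically small in `n₀` when `γ p < q - 1`; Markov's inequality on each consecutive dyadic
increment and the union bound). [cite: Legall2016, Thm 2.9 (proof)] -/
theorem measure_not_holderOnWith_le_of_isKolmogorovProcess (hX : IsKolmogorovProcess X P p q M)
    (hcont : ∀ᵐ ω ∂P, Continuous (X · ω)) {γ : ℝ≥0} (hγ0 : 0 < γ) (N n₀ : ℕ) :
    P {ω | ¬ HolderOnWith
      ((2 * (1 - (2 : ℝ≥0∞) ^ (-(γ : ℝ)))⁻¹ * ((N : ℝ≥0∞) * 2 ^ (n₀ + 1) + 1)).toNNReal)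
      γ (X · ω) (Icc 0 N)} ≤
      (N : ℝ≥0∞) * M * (((2 : ℝ≥0∞) ^ (-(q - 1 - γ * p))) ^ (n₀ + 1) *
        (1 - (2 : ℝ≥0∞) ^ (-(q - 1 - γ * p)))⁻¹) := by
  set ρ : ℝ≥0∞ := (2 : ℝ≥0∞) ^ (-(q - 1 - γ * p)) with hρ
  have hmain := measure_not_holderOnWith_le_tsum P hcont hγ0 N n₀
    (bnd := fun m ↦ (M : ℝ≥0∞) * ((2 : ℝ≥0∞)⁻¹ ^ m) ^ q / (((2 : ℝ≥0∞) ^ (-(γ : ℝ))) ^ m) ^ p)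
    (fun m _ k _ ↦ measure_increment_gt_le hX γ m k)
  beta_reduce at hmain
  refine hmain.trans (le_of_eq ?_)
  have hterm : ∀ i, ((N * 2 ^ (n₀ + 1 + i) : ℕ) : ℝ≥0∞) *
      ((M : ℝ≥0∞) * ((2 : ℝ≥0∞)⁻¹ ^ (n₀ + 1 + i)) ^ q /
        (((2 : ℝ≥0∞) ^ (-(γ : ℝ))) ^ (n₀ + 1 + i)) ^ p) = (N : ℝ≥0∞) * M * ρ ^ (n₀ + 1 + i) := by
    intro i
    have := card_mul_bound_rpow_eq (M := M) (p := p) (q := q) (γ : ℝ) (n₀ + 1 + i)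
    push_cast
    rw [mul_assoc, this, hρ]
    ring
  simp_rw [hterm, pow_add _ (n₀ + 1)]
  rw [ENNReal.tsum_mul_left, ENNReal.tsum_mul_left, ENNReal.tsum_geometric]

/-- The bound of `measure_not_holderOnWith_le_of_isKolmogorovProcess` tends to `0` as the level
`n₀ → ∞` (`θ = q - 1 - γ p > 0`). [folklore] -/
theorem tendsto_kolmogorovHolderBound (N : ℕ) (M : ℝ≥0) {θ : ℝ} (hθ : 0 < θ) :
    Tendsto (fun n₀ : ℕ ↦ (N : ℝ≥0∞) * M * (((2 : ℝ≥0∞) ^ (-θ)) ^ (n₀ + 1) *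
      (1 - (2 : ℝ≥0∞) ^ (-θ))⁻¹)) atTop (𝓝 0) := by
  set ρ : ℝ≥0∞ := (2 : ℝ≥0∞) ^ (-θ) with hρ
  have hρ1 : ρ < 1 := two_rpow_neg_lt_one' hθ
  have h1 : Tendsto (fun n₀ : ℕ ↦ ρ ^ (n₀ + 1)) atTop (𝓝 0) :=
    (ENNReal.tendsto_pow_atTop_nhds_zero_iff.2 hρ1).comp (tendsto_add_atTop_nat 1)
  have h2 : Tendsto (fun n₀ : ℕ ↦ ρ ^ (n₀ + 1) * (1 - ρ)⁻¹) atTop (𝓝 0) := by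
    have := ENNReal.Tendsto.mul_const h1 (b := (1 - ρ)⁻¹)
      (Or.inr (ENNReal.inv_ne_top.2 (tsub_pos_of_lt hρ1).ne'))
    rwa [zero_mul] at this
  have h3 := ENNReal.Tendsto.const_mul h2 (a := (N : ℝ≥0∞) * M)
    (Or.inr (ENNReal.mul_ne_top (ENNReal.natCast_ne_top N) ENNReal.coe_ne_top))
  rwa [mul_zero] at h3

end Kolmogorov

/-! ### Sub-exponential increment tails: the rate and the level threshold -/

section SubExpRate

/-- The diffusive rate `r = √2 · 2^{-α} = 2^{1/2 - α}` (the exponent `c λ / √h` of the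
sub-exponential tail at the dyadic scale `h = 2^{-m}` with threshold `λ = 2^{-α m}` is `c r^m`)
exceeds `1` for `α < 1/2`. [folklore] -/
theorem one_lt_sqrt_two_mul_two_rpow_neg {α : ℝ} (hα : α < 1 / 2) :
    1 < Real.sqrt 2 * (2 : ℝ) ^ (-α) := by
  rw [Real.sqrt_eq_rpow, ← Real.rpow_add two_pos]
  exact Real.one_lt_rpow one_lt_two (by linarith)

/-- The threshold identity at the dyadic scale: `2^{-α m} / √(2^{-m}) = r^m`. [folklore] -/
theorem threshold_div_sqrt (α : ℝ) (m : ℕ) :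
    ((2 : ℝ) ^ (-α)) ^ m / Real.sqrt (((2 : ℝ) ^ m)⁻¹) = (Real.sqrt 2 * (2 : ℝ) ^ (-α)) ^ m := by
  have hsq : Real.sqrt ((2 : ℝ) ^ m) = Real.sqrt 2 ^ m := by
    rw [show ((2 : ℝ) ^ m) = (Real.sqrt 2 ^ m) ^ 2 by
      rw [← pow_mul, mul_comm, pow_mul, Real.sq_sqrt zero_le_two]]
    exact Real.sqrt_sq (by positivity)
  rw [Real.sqrt_inv, hsq, div_inv_eq_mul, mul_pow, mul_comm]

/-- **Eventually `2^m K e^{-c r^m} ≤ 2^{-m}`** (`r > 1`, `c > 0`): the super-exponential decay of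
the sub-exponential tail at the dyadic scales beats the number `2^m` of increments per unit
length, with a geometric factor to spare (KS: "`K 2^n e^{-(c/4) T^{-1/2} 2^{(1/2-α) n}} ≤ 2^{-n}`
for `n` large enough"). [cite: KemppainenSmirnov2017, Prop. 3.8 (2) (proof)] -/
theorem eventually_two_pow_mul_exp_le' {r : ℝ} (hr : 1 < r) (K : ℝ) {c : ℝ} (hc : 0 < c) :
    ∀ᶠ m : ℕ in atTop, (2 : ℝ) ^ m * (K * Real.exp (-(c * r ^ m))) ≤ ((2 : ℝ) ^ m)⁻¹ := by
  rcases le_or_gt K 0 with hK | hK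
  · refine Eventually.of_forall fun m ↦ ?_
    have : (2 : ℝ) ^ m * (K * Real.exp (-(c * r ^ m))) ≤ 0 :=
      mul_nonpos_of_nonneg_of_nonpos (by positivity)
        (mul_nonpos_of_nonpos_of_nonneg hK (Real.exp_pos _).le)
    exact this.trans (by positivity)
  -- `m / r^m → 0` and `r^m → ∞`
  have hlog4 : 0 < Real.log 4 := Real.log_pos (by norm_num)
  have h1 : Tendsto (fun m : ℕ ↦ (m : ℝ) ^ 1 / r ^ m) atTop (𝓝 0) :=
    tendsto_pow_const_div_const_pow_of_one_lt 1 hr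
  have h2 : Tendsto (fun m : ℕ ↦ r ^ m) atTop atTop := tendsto_pow_atTop_atTop_of_one_lt hr
  have hA : ∀ᶠ m : ℕ in atTop, (m : ℝ) ^ 1 / r ^ m ≤ c / (2 * Real.log 4) :=
    (h1.eventually_lt_const (div_pos hc (mul_pos two_pos hlog4))).mono fun m hm ↦ hm.le
  have hB : ∀ᶠ m : ℕ in atTop, 2 * Real.log K ≤ c * r ^ m :=
    (h2.eventually_ge_atTop (2 * Real.log K / c)).mono fun m hm ↦ by
      rw [div_le_iff₀ hc] at hm
      linarith [mul_comm (r ^ m) c]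
  filter_upwards [hA, hB] with m hA hB
  have hrm : 0 < r ^ m := pow_pos (zero_lt_one.trans hr) m
  rw [pow_one, div_le_div_iff₀ hrm (mul_pos two_pos hlog4)] at hA
  -- `c r^m ≥ m log 4 + log K`
  have hkey : (m : ℝ) * Real.log 4 + Real.log K ≤ c * r ^ m := by
    linarith [hA, hB, show (m : ℝ) * (2 * Real.log 4) = 2 * ((m : ℝ) * Real.log 4) by ring]
  -- exponentiate
  have hexp : K * Real.exp (-(c * r ^ m)) ≤ ((4 : ℝ) ^ m)⁻¹ := by
    have h4 : ((4 : ℝ) ^ m)⁻¹ = Real.exp (-((m : ℝ) * Real.log 4)) := by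
      rw [Real.exp_neg, ← Real.log_pow, Real.exp_log (by positivity)]
    rw [h4, ← Real.exp_log hK, ← Real.exp_add]
    exact Real.exp_le_exp.2 (by linarith)
  have h42 : ((4 : ℝ) ^ m)⁻¹ = ((2 : ℝ) ^ m)⁻¹ * ((2 : ℝ) ^ m)⁻¹ := by
    rw [← mul_inv, ← mul_pow]; norm_num
  calc (2 : ℝ) ^ m * (K * Real.exp (-(c * r ^ m))) ≤ (2 : ℝ) ^ m * ((4 : ℝ) ^ m)⁻¹ := by
        gcongr
    _ = ((2 : ℝ) ^ m)⁻¹ := by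
        rw [h42, ← mul_assoc, mul_inv_cancel₀ (by positivity), one_mul]

/-- The `ℝ≥0∞` threshold `((2 : ℝ≥0∞)^{-α})^m` is `ENNReal.ofReal` of the real one. [folklore] -/
theorem two_rpow_neg_pow_eq_ofReal (α : ℝ) (m : ℕ) :
    ((2 : ℝ≥0∞) ^ (-α)) ^ m = ENNReal.ofReal (((2 : ℝ) ^ (-α)) ^ m) := by
  rw [ENNReal.ofReal_pow (by positivity), ← ENNReal.ofReal_rpow_of_pos two_pos,
    ENNReal.ofReal_ofNat]

end SubExpRate

end KolmogorovChentsov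

/-! ### Tightness of Hölder norms under Kolmogorov's moment condition -/

section KolmogorovTight

variable [PseudoEMetricSpace E]

/-- **Tightness of Hölder norms under Kolmogorov's condition (uniform in the process).** For
exponents `p, q`, a constant `M`, `0 < γ` with `γ p < q - 1`, a horizon `N` and `ε > 0` there
is ONE constant `C` such that every process `X : ℝ≥0 → Ω → E` (on any measurable space, any
measure) with almost surely continuous paths satisfying the Kolmogorov condition with `(p, q, M)`
is `γ`-Hölder on `[0, N]` with constant `C` outside an event of measure `≤ ε`: the moment
criterion for tightness in `C([0, N], E)` in Hölder-ball form. [cite: Legall2016, Thm 2.9 (proof)] -/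
theorem exists_holderConst_of_isKolmogorovProcess {p q : ℝ} (M : ℝ≥0) {γ : ℝ≥0} (hγ0 : 0 < γ)
    (hγ : (γ : ℝ) * p < q - 1) (N : ℕ) {ε : ℝ≥0∞} (hε : 0 < ε) :
    ∃ C : ℝ≥0, ∀ {Ω : Type u} {mΩ : MeasurableSpace Ω} (P : Measure Ω) (X : ℝ≥0 → Ω → E),
      IsKolmogorovProcess X P p q M → (∀ᵐ ω ∂P, Continuous (X · ω)) →
        P {ω | ¬ HolderOnWith C γ (X · ω) (Icc 0 N)} ≤ ε := by
  have hθ : 0 < q - 1 - γ * p := by linarith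
  obtain ⟨n₀, hn₀⟩ := ((tendsto_kolmogorovHolderBound N M hθ).eventually_lt_const hε).exists
  exact ⟨_, fun P X hX hcont ↦
    (measure_not_holderOnWith_le_of_isKolmogorovProcess hX hcont hγ0 N n₀).trans hn₀.le⟩

end KolmogorovTight

/-! ### Kemppainen–Smirnov: sub-exponential increment tails (Prop. 3.8 (2), Thm. 3.9) -/

section SubExp

variable [PseudoMetricSpace E] {Ω : Type*} [MeasurableSpace Ω]

/-- **Kemppainen–Smirnov Prop. 3.8 (2), quantitative form.** Let `X : ℝ≥0 → Ω → E` have almost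
surely continuous paths and sub-exponential two-time increment tails on `[0, N]`:
`P{λ ≤ d(X_s, X_t)} ≤ K exp(-c λ / √(t - s))` for `s < t ≤ N`, `t - s ≤ 1`, `λ > 0`. If the
level `n₀` is so large that `2^m K e^{-c r^m} ≤ 2^{-m}` for all `m > n₀` (`r = 2^{1/2-α}`; such
`n₀` exist for
`α < 1/2`, `eventually_two_pow_mul_exp_le'`, and depend on `(α, K, c)` only), then the paths fail
to be `α`-Hölder on `[0, N]` with the explicit constant `C(α, n₀, N)` with probability at most
`N 2^{-n₀}` (union bound over the consecutive level-`m` dyadic increments, `m > n₀`, each of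
probability `≤ K e^{-c r^m}`). [cite: KemppainenSmirnov2017, Prop. 3.8 (2)] -/
theorem measure_not_holderOnWith_le_of_subexp_tails {α : ℝ≥0} (hα0 : 0 < α) {K c : ℝ}
    {N n₀ : ℕ}
    (hn₀ : ∀ m, n₀ < m →
      (2 : ℝ) ^ m * (K * Real.exp (-(c * (Real.sqrt 2 * (2 : ℝ) ^ (-(α : ℝ))) ^ m))) ≤
        ((2 : ℝ) ^ m)⁻¹)
    (P : Measure Ω) {X : ℝ≥0 → Ω → E} (hcont : ∀ᵐ ω ∂P, Continuous (X · ω))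
    (htail : ∀ s t : ℝ≥0, s < t → (t : ℝ) ≤ N → (t : ℝ) - s ≤ 1 → ∀ l : ℝ, 0 < l →
      P {ω | l ≤ dist (X s ω) (X t ω)} ≤
        ENNReal.ofReal (K * Real.exp (-(c * l / Real.sqrt ((t : ℝ) - s))))) :
    P {ω | ¬ HolderOnWith
      ((2 * (1 - (2 : ℝ≥0∞) ^ (-(α : ℝ)))⁻¹ * ((N : ℝ≥0∞) * 2 ^ (n₀ + 1) + 1)).toNNReal)
      α (X · ω) (Icc 0 N)} ≤
      (N : ℝ≥0∞) * (2 : ℝ≥0∞)⁻¹ ^ n₀ := by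
  have hα0' : 0 < (α : ℝ) := NNReal.coe_pos.2 hα0
  -- single-increment bound at level `m`
  set pm : ℕ → ℝ≥0∞ :=
    fun m ↦ ENNReal.ofReal (K * Real.exp (-(c * (Real.sqrt 2 * (2 : ℝ) ^ (-(α : ℝ))) ^ m)))
    with hpm
  have hp : ∀ m, n₀ < m → ∀ k, k + 1 ≤ N * 2 ^ m →
      P {ω | ((2 : ℝ≥0∞) ^ (-(α : ℝ))) ^ m < edist (X (dyad m k) ω) (X (dyad m (k + 1)) ω)} ≤
        pm m := by
    intro m hm k hk
    have hst : dyad m k < dyad m (k + 1) := by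
      rw [← NNReal.coe_lt_coe, coe_dyad, coe_dyad]
      gcongr
      linarith
    have htN : ((dyad m (k + 1) : ℝ≥0) : ℝ) ≤ N := by
      rw [coe_dyad, div_le_iff₀ (by positivity)]
      exact_mod_cast hk
    have hdiff : ((dyad m (k + 1) : ℝ≥0) : ℝ) - dyad m k = ((2 : ℝ) ^ m)⁻¹ := by
      rw [coe_dyad, coe_dyad]
      push_cast
      ring
    have hle1 : ((dyad m (k + 1) : ℝ≥0) : ℝ) - dyad m k ≤ 1 := by
      rw [hdiff, inv_le_one_iff₀]
      exact Or.inr (one_le_pow₀ one_le_two)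
    have hl : 0 < ((2 : ℝ) ^ (-(α : ℝ))) ^ m := by positivity
    have hmono : {ω | ((2 : ℝ≥0∞) ^ (-(α : ℝ))) ^ m <
        edist (X (dyad m k) ω) (X (dyad m (k + 1)) ω)} ⊆
        {ω | ((2 : ℝ) ^ (-(α : ℝ))) ^ m ≤ dist (X (dyad m k) ω) (X (dyad m (k + 1)) ω)} := by
      intro ω hω
      simp only [Set.mem_setOf_eq, two_rpow_neg_pow_eq_ofReal, edist_dist] at hω ⊢
      exact ((ENNReal.ofReal_lt_ofReal_iff_of_nonneg hl.le).1 hω).le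
    calc P _ ≤ P {ω | ((2 : ℝ) ^ (-(α : ℝ))) ^ m ≤ dist (X (dyad m k) ω) (X (dyad m (k + 1)) ω)} :=
          measure_mono hmono
      _ ≤ ENNReal.ofReal (K * Real.exp (-(c * ((2 : ℝ) ^ (-(α : ℝ))) ^ m /
            Real.sqrt (((dyad m (k + 1) : ℝ≥0) : ℝ) - dyad m k)))) :=
          htail _ _ hst htN hle1 _ hl
      _ = pm m := by rw [hpm, hdiff, mul_div_assoc, threshold_div_sqrt]
  have hmain := measure_not_holderOnWith_le_tsum P hcont hα0 N n₀ hp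
  refine hmain.trans ?_
  -- the terms are `≤ N (2⁻¹)^m`
  have hterm : ∀ i, ((N * 2 ^ (n₀ + 1 + i) : ℕ) : ℝ≥0∞) * pm (n₀ + 1 + i) ≤
      (N : ℝ≥0∞) * ((2 : ℝ≥0∞)⁻¹ ^ (n₀ + 1) * (2 : ℝ≥0∞)⁻¹ ^ i) := by
    intro i
    have hm := hn₀ (n₀ + 1 + i) (by omega)
    have h2 : ((N * 2 ^ (n₀ + 1 + i) : ℕ) : ℝ≥0∞) * pm (n₀ + 1 + i) =
        (N : ℝ≥0∞) * ENNReal.ofReal ((2 : ℝ) ^ (n₀ + 1 + i) *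
          (K * Real.exp (-(c * (Real.sqrt 2 * (2 : ℝ) ^ (-(α : ℝ))) ^ (n₀ + 1 + i))))) := by
      rw [ENNReal.ofReal_mul (by positivity), ENNReal.ofReal_pow zero_le_two (n₀ + 1 + i),
        ENNReal.ofReal_ofNat]
      simp only [hpm]
      push_cast
      ring
    rw [h2, ← pow_add]
    gcongr
    calc ENNReal.ofReal ((2 : ℝ) ^ (n₀ + 1 + i) *
          (K * Real.exp (-(c * (Real.sqrt 2 * (2 : ℝ) ^ (-(α : ℝ))) ^ (n₀ + 1 + i)))))
        ≤ ENNReal.ofReal (((2 : ℝ) ^ (n₀ + 1 + i))⁻¹) := ENNReal.ofReal_le_ofReal hm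
      _ = (2 : ℝ≥0∞)⁻¹ ^ (n₀ + 1 + i) := by
          rw [ENNReal.ofReal_inv_of_pos (by positivity), ENNReal.ofReal_pow zero_le_two,
            ENNReal.ofReal_ofNat, ENNReal.inv_pow]
  calc ∑' i, ((N * 2 ^ (n₀ + 1 + i) : ℕ) : ℝ≥0∞) * pm (n₀ + 1 + i)
      ≤ ∑' i, (N : ℝ≥0∞) * ((2 : ℝ≥0∞)⁻¹ ^ (n₀ + 1) * (2 : ℝ≥0∞)⁻¹ ^ i) :=
        ENNReal.tsum_le_tsum hterm
    _ = (N : ℝ≥0∞) * (2 : ℝ≥0∞)⁻¹ ^ n₀ := by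
        rw [ENNReal.tsum_mul_left, ENNReal.tsum_mul_left, ENNReal.tsum_geometric,
          ENNReal.one_sub_inv_two, inv_inv, pow_succ, mul_assoc ((2 : ℝ≥0∞)⁻¹ ^ n₀),
          ENNReal.inv_mul_cancel (by norm_num) (by norm_num), mul_one]

/-- **Kemppainen–Smirnov Thm. 3.9 in path form: sub-exponential increment tails make the Hölder
norm stochastically bounded, uniformly in the process.** For `0 < α < 1/2`, constants `K`,
`c > 0`, a horizon `N` and `ε > 0` there is ONE constant `C` such that every process `X` (on any
measurable space, any measure `P`) with almost surely continuous paths and increment tails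
`P{λ ≤ d(X_s, X_t)} ≤ K exp(-c λ / √(t - s))` (`s < t ≤ N`, `t - s ≤ 1`, `λ > 0`) is
`α`-Hölder on `[0, N]` with constant `C` outside an event of measure `≤ ε`. For the Loewner
driving processes of a family of random curves satisfying Condition G2 the tail bound is KS
Prop. 3.7 with eq. (10), and the conclusion is the event `E₃` of KS §3.5 ("simple curves with Hölder continuous driving
process … Hölder constant `K_d` chosen to satisfy `P(E₃) ≥ 1 - ε/4`").
[cite: KemppainenSmirnov2017, Thm. 3.9] -/
theorem exists_holderConst_of_subexp_tails {α : ℝ≥0} (hα0 : 0 < α) (hα : (α : ℝ) < 1 / 2)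
    (K : ℝ) {c : ℝ} (hc : 0 < c) (N : ℕ) {ε : ℝ≥0∞} (hε : 0 < ε) :
    ∃ C : ℝ≥0, ∀ {Ω : Type u} {mΩ : MeasurableSpace Ω} (P : Measure Ω) (X : ℝ≥0 → Ω → E),
      (∀ᵐ ω ∂P, Continuous (X · ω)) →
      (∀ s t : ℝ≥0, s < t → (t : ℝ) ≤ N → (t : ℝ) - s ≤ 1 → ∀ l : ℝ, 0 < l →
        P {ω | l ≤ dist (X s ω) (X t ω)} ≤
          ENNReal.ofReal (K * Real.exp (-(c * l / Real.sqrt ((t : ℝ) - s))))) →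
      P {ω | ¬ HolderOnWith C α (X · ω) (Icc 0 N)} ≤ ε := by
  -- the geometric bound `N 2^{-n₀} → 0`
  have hlim : Tendsto (fun n₀ : ℕ ↦ (N : ℝ≥0∞) * (2 : ℝ≥0∞)⁻¹ ^ n₀) atTop (𝓝 0) := by
    have h1 : Tendsto (fun n₀ : ℕ ↦ (2 : ℝ≥0∞)⁻¹ ^ n₀) atTop (𝓝 0) :=
      ENNReal.tendsto_pow_atTop_nhds_zero_iff.2 (ENNReal.inv_lt_one.2 ENNReal.one_lt_two)
    have := ENNReal.Tendsto.const_mul h1 (a := (N : ℝ≥0∞)) (Or.inr (ENNReal.natCast_ne_top N))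
    rwa [mul_zero] at this
  -- the level beyond which `2^m K e^{-c r^m} ≤ 2^{-m}`
  have hev : ∀ᶠ n₀ : ℕ in atTop, ∀ m, n₀ < m →
      (2 : ℝ) ^ m * (K * Real.exp (-(c * (Real.sqrt 2 * (2 : ℝ) ^ (-(α : ℝ))) ^ m))) ≤ ((2 : ℝ) ^ m)⁻¹ := by
    obtain ⟨n₁, hn₁⟩ :=
      eventually_atTop.1 (eventually_two_pow_mul_exp_le' (one_lt_sqrt_two_mul_two_rpow_neg hα) K hc)
    exact eventually_atTop.2 ⟨n₁, fun n₀ hn₀ m hm ↦ hn₁ m (by omega)⟩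
  obtain ⟨n₀, h1, h2⟩ := (hev.and (hlim.eventually_lt_const hε)).exists
  exact ⟨_, fun P X hcont htail ↦
    (measure_not_holderOnWith_le_of_subexp_tails hα0 h1 P hcont htail).trans h2.le⟩

/-- **Kemppainen–Smirnov's event `E₃` (§3.5): one driving modulus for all horizons.** For
`0 < α < 1/2`, horizon-dependent constants `K T`, `c T > 0` and `ε > 0` there are moduli
`μ T : ℝ → ℝ` (`T : ℕ`), each tending to `0` at `0⁺`, such that every process `X` (any space,
any measure `P`) with almost surely continuous paths and, on every `[0, T]`, the increment tails
`P{λ ≤ d(X_s, X_t)} ≤ K_T exp(-c_T λ / √(t - s))` (`s < t ≤ T`, `t - s ≤ 1`, `λ > 0`) satisfies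
`d(X_s, X_t) ≤ μ T (|s - t|)` for all `T` and all `s, t ≤ T`, outside ONE event of measure
`≤ ε`: `μ T h = C_T h^α` with the constant of `exists_holderConst_of_subexp_tails` at level
`ε 2^{-(T+1)}`, and the union bound over `T`. This is the clause `driving_modulus` (moduli
`drvMod T`, `T : ℕ`) of `RandomPlanarGeometry.IsRegularCurve` with its probability estimate, for
the law of any process with such tails — KS §3.5: "`E₃` is the set of simple curves with Hölder
continuous driving process … chosen to satisfy `P(E₃) ≥ 1 - ε/4` … for all `P ∈ Σ_𝔻`".
[cite: KemppainenSmirnov2017, Thm. 3.9 and §3.5] -/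
theorem exists_modulus_of_subexp_tails {α : ℝ≥0} (hα0 : 0 < α) (hα : (α : ℝ) < 1 / 2)
    (K c : ℕ → ℝ) (hc : ∀ T, 0 < c T) {ε : ℝ≥0∞} (hε : 0 < ε) :
    ∃ μ : ℕ → ℝ → ℝ, (∀ T, Tendsto (μ T) (𝓝[>] 0) (𝓝 0)) ∧
      ∀ {Ω : Type u} {mΩ : MeasurableSpace Ω} (P : Measure Ω) (X : ℝ≥0 → Ω → E),
        (∀ᵐ ω ∂P, Continuous (X · ω)) →
        (∀ (T : ℕ) (s t : ℝ≥0), s < t → (t : ℝ) ≤ T → (t : ℝ) - s ≤ 1 → ∀ l : ℝ, 0 < l →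
          P {ω | l ≤ dist (X s ω) (X t ω)} ≤
            ENNReal.ofReal (K T * Real.exp (-(c T * l / Real.sqrt ((t : ℝ) - s))))) →
        P {ω | ∃ (T : ℕ) (s t : ℝ≥0), (s : ℝ) ≤ T ∧ (t : ℝ) ≤ T ∧
          μ T (dist s t) < dist (X s ω) (X t ω)} ≤ ε := by
  -- per-horizon constants at the levels `ε 2^{-(T+1)}`
  have hεT : ∀ T : ℕ, 0 < ε * (2 : ℝ≥0∞)⁻¹ ^ (T + 1) := fun T ↦
    ENNReal.mul_pos hε.ne' (ENNReal.pow_pos (by norm_num) _).ne'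
  choose C hC using fun T : ℕ ↦
    exists_holderConst_of_subexp_tails (E := E) hα0 hα (K T) (hc T) T (hεT T)
  refine ⟨fun T h ↦ C T * h ^ (α : ℝ), fun T ↦ ?_, fun P X hcont htail ↦ ?_⟩
  · -- `C_T h^α → 0` as `h → 0⁺`
    have hα0' : 0 < (α : ℝ) := NNReal.coe_pos.2 hα0
    have h1 : Tendsto (fun h : ℝ ↦ h ^ (α : ℝ)) (𝓝 0) (𝓝 0) := by
      have := (Real.continuous_rpow_const hα0'.le).tendsto 0
      rwa [Real.zero_rpow hα0'.ne'] at this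
    have h2 := h1.const_mul (C T : ℝ)
    rw [mul_zero] at h2
    exact h2.mono_left nhdsWithin_le_nhds
  · -- the union bound over the horizons
    have hsub : {ω | ∃ (T : ℕ) (s t : ℝ≥0), (s : ℝ) ≤ T ∧ (t : ℝ) ≤ T ∧
        C T * dist s t ^ (α : ℝ) < dist (X s ω) (X t ω)} ⊆
        ⋃ T : ℕ, {ω | ¬ HolderOnWith (C T) α (X · ω) (Icc 0 T)} := by
      rintro ω ⟨T, s, t, hs, ht, hlt⟩
      refine Set.mem_iUnion.2 ⟨T, fun hH ↦ ?_⟩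
      have := hH.dist_le ⟨zero_le, by exact_mod_cast hs⟩ ⟨zero_le, by exact_mod_cast ht⟩
      exact absurd hlt (not_lt.2 this)
    calc P {ω | ∃ (T : ℕ) (s t : ℝ≥0), (s : ℝ) ≤ T ∧ (t : ℝ) ≤ T ∧
          C T * dist s t ^ (α : ℝ) < dist (X s ω) (X t ω)}
        ≤ P (⋃ T : ℕ, {ω | ¬ HolderOnWith (C T) α (X · ω) (Icc 0 T)}) := measure_mono hsub
      _ ≤ ∑' T : ℕ, P {ω | ¬ HolderOnWith (C T) α (X · ω) (Icc 0 T)} := measure_iUnion_le _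
      _ ≤ ∑' T : ℕ, ε * (2 : ℝ≥0∞)⁻¹ ^ (T + 1) :=
          ENNReal.tsum_le_tsum fun T ↦ hC T P X hcont (htail T)
      _ = ε := by
          simp_rw [pow_succ, ← mul_assoc]
          rw [ENNReal.tsum_mul_right, ENNReal.tsum_mul_left, ENNReal.tsum_geometric,
            ENNReal.one_sub_inv_two, inv_inv, mul_assoc,
            ENNReal.mul_inv_cancel (by norm_num) (by norm_num), mul_one]

/-- **Box form: uniform moduli at the levels `[0, k+1]`.** For `0 < α < 1/2`, horizon-dependent
constants `K T`, `c T > 0` and `ε > 0` there are scales `δW k > 0` such that every process `X`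
with almost surely continuous paths and the increment tails
`P{λ ≤ d(X_s, X_t)} ≤ K_T exp(-c_T λ / √(t - s))` on every `[0, T]` satisfies, outside ONE event
of measure `≤ ε`, the box moduli "`s, t ≤ k + 1`, `|s - t| ≤ δW k` ⟹ `d(X_s, X_t) ≤ 1/(k+1)`"
for all `k` — the defining clauses of `Process.modulusSet` (`PathSpaceTightness.lean`, the compact
boxes of Loewner pairs in `RandomPlanarGeometry/LoewnerTransformContinuity.lean` and
`LoewnerRegularBoxes.lean`), with scales depending on `(α, K, c, ε)` only. From
`exists_modulus_of_subexp_tails` by choosing `δW k` below the scale at which the modulus of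
level `k + 1` drops under `1/(k+1)`. [cite: KemppainenSmirnov2017, Thm. 3.9 and §3.5] -/
theorem exists_scales_of_subexp_tails {α : ℝ≥0} (hα0 : 0 < α) (hα : (α : ℝ) < 1 / 2)
    (K c : ℕ → ℝ) (hc : ∀ T, 0 < c T) {ε : ℝ≥0∞} (hε : 0 < ε) :
    ∃ δW : ℕ → ℝ, (∀ k, 0 < δW k) ∧
      ∀ {Ω : Type u} {mΩ : MeasurableSpace Ω} (P : Measure Ω) (X : ℝ≥0 → Ω → E),
        (∀ᵐ ω ∂P, Continuous (X · ω)) →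
        (∀ (T : ℕ) (s t : ℝ≥0), s < t → (t : ℝ) ≤ T → (t : ℝ) - s ≤ 1 → ∀ l : ℝ, 0 < l →
          P {ω | l ≤ dist (X s ω) (X t ω)} ≤
            ENNReal.ofReal (K T * Real.exp (-(c T * l / Real.sqrt ((t : ℝ) - s))))) →
        P {ω | ∃ (k : ℕ) (s t : ℝ≥0), (s : ℝ) ≤ k + 1 ∧ (t : ℝ) ≤ k + 1 ∧ dist s t ≤ δW k ∧
          1 / ((k : ℝ) + 1) < dist (X s ω) (X t ω)} ≤ ε := by
  obtain ⟨μ, hμ, hP⟩ := exists_modulus_of_subexp_tails (E := E) hα0 hα K c hc hε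
  -- the scales: `μ (k+1) d ≤ 1/(k+1)` for `0 < d ≤ δW k`
  have hk : ∀ k : ℕ, ∃ δ : ℝ, 0 < δ ∧
      ∀ d : ℝ, 0 < d → d ≤ δ → μ (k + 1) d ≤ 1 / ((k : ℝ) + 1) := by
    intro k
    have hpos : (0 : ℝ) < 1 / ((k : ℝ) + 1) := by positivity
    have hev : ∀ᶠ d in 𝓝[>] (0 : ℝ), dist (μ (k + 1) d) 0 < 1 / ((k : ℝ) + 1) :=
      Metric.tendsto_nhds.1 (hμ (k + 1)) _ hpos
    rw [eventually_nhdsWithin_iff, Metric.eventually_nhds_iff] at hev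
    obtain ⟨e, he, hep⟩ := hev
    refine ⟨e / 2, half_pos he, fun d hd hde ↦ ?_⟩
    have h1 : dist d 0 < e := by
      rw [Real.dist_0_eq_abs, abs_of_pos hd]
      linarith
    have h2 := hep h1 hd
    rw [Real.dist_0_eq_abs] at h2
    exact (le_abs_self _).trans h2.le
  choose δW hδW hmod using hk
  refine ⟨δW, hδW, fun P X hcont htail ↦ le_trans (measure_mono ?_) (hP P X hcont htail)⟩
  -- a violation of a box modulus is a violation of the modulus `μ (k+1)`
  rintro ω ⟨k, s, t, hs, ht, hst, hlt⟩
  refine ⟨k + 1, s, t, by push_cast; exact hs, by push_cast; exact ht, ?_⟩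
  rcases eq_or_lt_of_le (dist_nonneg : (0 : ℝ) ≤ dist s t) with h0 | hpos
  · -- `s = t` is impossible
    have hst0 : dist (X s ω) (X t ω) = 0 := by
      rw [dist_eq_zero.1 h0.symm, dist_self]
    rw [hst0] at hlt
    exact absurd hlt (not_lt.2 (by positivity))
  · exact (hmod k _ hpos hst).trans_lt hlt

end SubExp

end Literature.Probability.Process
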